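import Literature.MathematicalPhysics.QuantumFieldTheory.Balaban1983to89.Node00.CriticalOnFibre

/-!
# NODE 00 — THE FIRST VARIATION OF THE WILSON ACTION (5) ALONG A CURVE OF `SU(N)` CONFIGURATIONS (the lattice Yang–Mills equation's left side, at the objects
# of record): the derivative FORMULA, the tangent condition from unitarity, and the criticality test «first variation vanishes ⇒ critical on every fibre»

Cell `pub-ymgap`, seat `pub-ymgap-dag-n07-e` generation 8 (R141 (C), DAG node N07 = [15] = [Balaban1985Variational]; ROW P11; the successor brick named in this
seat's LOCATED-M5, INBOX l.18464: a kernel certificate of M5 — «an unconstrained lattice Yang–Mills solution in the small class is critical on the empty fibre» —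
needs the first variation of (5), which the tree had only as an EXISTENCE statement, `differentiableAt_wilsonAction4_along` of `Node00/CriticalOfRecord` §2b).
NEW leaf; `Node00.CriticalOnFibre` (this seat) CONSUMED BY NAME.  `--kind proof --supports stmt-QuantumFields-20289` (count-neutral bookkeeping; 0 def).

PRINT.  [15] (5) p. 278: `A(U) = Σ_p (1 − Re tr U(∂p) ∕ N)`; Sect. F p. 300 [24]: «critical configurations of the functional (5)»; [6] (1.1)–(1.2), (1.9) pp. 76–77: the
covariant co-divergence `D^{η*}_U ∂U` — the lattice Yang–Mills current whose vanishing is criticality of (5) (print uses this silently throughout Sect. F).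

WHAT THIS FILE DOES (torus `P`, level `j`, `SU(N)`; a curve `γ : ℝ → GaugeField P j (SU N)` with bond-wise derivatives `X b` at `t₀`, i.e.
`HasDerivAt (fun t => ↑(γ t b)) (X b) t₀` in `M_N(ℂ)`):
* §1 ★ `hasDerivAt_coe_plaqHol` — the derivative of `t ↦ ↑(γ t)(∂p) = A·B·C⋆·D⋆` is the four-term Leibniz sum `A′BC⋆D⋆ + AB′C⋆D⋆ + AB(C′)⋆D⋆ + ABC⋆(D′)⋆`
  (`↑(g⁻¹) = (↑g)⋆` on `SU(N)`, definitional); `hasDerivAt_reTr_plaqHol` (composition with the continuous ℝ-linear `Re Tr ∕ N`); ★ `hasDerivAt_wilsonAction4`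
  — `(A ∘ γ)′(t₀) = −(1∕N)·Σ_p Re Tr (that four-term sum)`.
* §2 `star_deriv_mul_add_eq_zero` — the TANGENT CONDITION from unitarity: `(X b)⋆·↑(γ t₀ b) + ↑(γ t₀ b)⋆·X b = 0` (differentiate `U⋆U = 1`); hence
  `re_trace_star_mul_deriv_eq_zero`: `Re Tr(↑(γ t₀ b)⋆ · X b) = 0`.
* §3 ★ `isCritOnFibre_of_firstVariation_eq_zero` — if at a configuration `U` the first variation `Σ_p Re Tr(…)` vanishes for EVERY bond-wise velocity family `X`
  satisfying the tangent condition at `U`, then `U` is a critical configuration of (5) on EVERY fibre (`IsCritOnFibre F N K 𝐁 W U` for all `𝐁`, `W`) — the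
  test a concrete lattice Yang–Mills solution (e.g. a uniform abelian flux) has to pass; the constraint is not used (an unconstrained critical point is critical
  on every fibre through it).

HONEST FRAMING: calculus bookkeeping about the tree's own action functional; nothing of Bałaban asserted; no lattice Yang–Mills solution is constructed here
(that, and the M5 certificate, are successor work); N07 ∕ K0⁗ NOT discharged; counts unmoved (5∕27); one finite T⁴ programme at fixed ε — NOT continuum ∕ ℝ⁴ ∕
OS ∕ mass gap ∕ Clay.  No `sorry`, no `def`, no `instance`.
-/

noncomputable section

namespace Literature.MathematicalPhysics.QuantumFieldTheory.Balaban1983to89.Node00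

open Filter Topology
open T4Continuum (T4Family)
open B15DeterminingSets
open scoped Matrix.Norms.L2Operator

/-! ## §1  The derivative of the plaquette holonomy, of its normalised trace, and of the Wilson action along a curve -/

section FirstVariation

variable {P : Params} {j : ℕ} {N : ℕ} [NeZero N]

/-- The matrix of a plaquette holonomy is the product `A·B·C⋆·D⋆` of the four bond matrices (`↑(g⁻¹) = (↑g)⋆` in `SU(N)`; definitional).
[cite: Balaban1985Averaging, (9) p.19 (bookkeeping)] -/
theorem coe_plaqHol_eq (U : GaugeField P j (SU N)) (p : Plaq P j) :
    ((GaugeField.plaqHol U p : SU N) : Matrix (Fin N) (Fin N) ℂ)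
      = (U ⟨p.src, p.μ⟩ : Matrix (Fin N) (Fin N) ℂ) * (U ⟨p.src.shift p.μ, p.ν⟩ : Matrix (Fin N) (Fin N) ℂ)
        * star (U ⟨p.src.shift p.ν, p.μ⟩ : Matrix (Fin N) (Fin N) ℂ) * star (U ⟨p.src, p.ν⟩ : Matrix (Fin N) (Fin N) ℂ) := by
  unfold GaugeField.plaqHol
  rfl

variable {γ : ℝ → GaugeField P j (SU N)} {X : PBond P j → Matrix (Fin N) (Fin N) ℂ} {t₀ : ℝ}

/-- ★ **THE DERIVATIVE OF A PLAQUETTE HOLONOMY ALONG A CURVE** (Leibniz over the four bond factors; the adjoint is ℝ-linear and continuous):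
`(↑γ(∂p))′ = A′BC⋆D⋆ + AB′C⋆D⋆ + AB(C′)⋆D⋆ + ABC⋆(D′)⋆` with `A = ↑(γ t₀ ⟨x, μ⟩)`, `B = ↑(γ t₀ ⟨x+e_μ, ν⟩)`, `C = ↑(γ t₀ ⟨x+e_ν, μ⟩)`, `D = ↑(γ t₀ ⟨x, ν⟩)` and primes
the bond-wise derivatives `X`. [cite: Balaban1985Variational, (5) p.278; Balaban1985Averaging, (9) p.19 (bookkeeping)] -/
theorem hasDerivAt_coe_plaqHol (hγ : ∀ b, HasDerivAt (fun t => ((γ t b : SU N) : Matrix (Fin N) (Fin N) ℂ)) (X b) t₀) (p : Plaq P j) :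
    HasDerivAt (fun t => ((GaugeField.plaqHol (γ t) p : SU N) : Matrix (Fin N) (Fin N) ℂ))
      (X ⟨p.src, p.μ⟩ * (γ t₀ ⟨p.src.shift p.μ, p.ν⟩ : Matrix (Fin N) (Fin N) ℂ) * star (γ t₀ ⟨p.src.shift p.ν, p.μ⟩ : Matrix (Fin N) (Fin N) ℂ)
          * star (γ t₀ ⟨p.src, p.ν⟩ : Matrix (Fin N) (Fin N) ℂ)
        + (γ t₀ ⟨p.src, p.μ⟩ : Matrix (Fin N) (Fin N) ℂ) * X ⟨p.src.shift p.μ, p.ν⟩ * star (γ t₀ ⟨p.src.shift p.ν, p.μ⟩ : Matrix (Fin N) (Fin N) ℂ)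
          * star (γ t₀ ⟨p.src, p.ν⟩ : Matrix (Fin N) (Fin N) ℂ)
        + (γ t₀ ⟨p.src, p.μ⟩ : Matrix (Fin N) (Fin N) ℂ) * (γ t₀ ⟨p.src.shift p.μ, p.ν⟩ : Matrix (Fin N) (Fin N) ℂ) * star (X ⟨p.src.shift p.ν, p.μ⟩)
          * star (γ t₀ ⟨p.src, p.ν⟩ : Matrix (Fin N) (Fin N) ℂ)
        + (γ t₀ ⟨p.src, p.μ⟩ : Matrix (Fin N) (Fin N) ℂ) * (γ t₀ ⟨p.src.shift p.μ, p.ν⟩ : Matrix (Fin N) (Fin N) ℂ)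
          * star (γ t₀ ⟨p.src.shift p.ν, p.μ⟩ : Matrix (Fin N) (Fin N) ℂ) * star (X ⟨p.src, p.ν⟩)) t₀ := by
  simp only [coe_plaqHol_eq]
  have h := (((hγ ⟨p.src, p.μ⟩).mul (hγ ⟨p.src.shift p.μ, p.ν⟩)).mul (hγ ⟨p.src.shift p.ν, p.μ⟩).star).mul (hγ ⟨p.src, p.ν⟩).star
  refine h.congr_deriv ?_
  simp only [Pi.mul_apply]
  noncomm_ring

/-- **The derivative of `Re tr U(∂p) ∕ N` along the curve** — the four-term sum read through the continuous ℝ-linear functional `Re Tr ∕ N`.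
[cite: Balaban1985Variational, (5) p.278; Balaban1987RG1, (0.2) p.252 (bookkeeping)] -/
theorem hasDerivAt_reTr_plaqHol (hγ : ∀ b, HasDerivAt (fun t => ((γ t b : SU N) : Matrix (Fin N) (Fin N) ℂ)) (X b) t₀) (p : Plaq P j)
    {M' : Matrix (Fin N) (Fin N) ℂ}
    (hM : HasDerivAt (fun t => ((GaugeField.plaqHol (γ t) p : SU N) : Matrix (Fin N) (Fin N) ℂ)) M' t₀) :
    HasDerivAt (fun t => reTr (GaugeField.plaqHol (γ t) p))
      (((Matrix.traceLinearMap (Fin N) ℝ ℂ) M').re / (Fintype.card (Fin N) : ℝ)) t₀ := by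
  have _ := hγ
  have h2 : HasDerivAt (fun t => ((Matrix.traceLinearMap (Fin N) ℝ ℂ) ((GaugeField.plaqHol (γ t) p : SU N) : Matrix (Fin N) (Fin N) ℂ)).re)
      (((Matrix.traceLinearMap (Fin N) ℝ ℂ) M').re) t₀ := by
    have hT := ((LinearMap.toContinuousLinearMap (Matrix.traceLinearMap (Fin N) ℝ ℂ)).hasFDerivAt.comp_hasDerivAt t₀ hM)
    exact (Complex.reCLM.hasFDerivAt.comp_hasDerivAt t₀ hT)
  simp only [reTr_eq_traceLinearMap]
  exact h2.div_const _

/-- ★ **THE FIRST VARIATION OF THE WILSON ACTION (5)**: along a curve with bond-wise derivatives, `t ↦ A(γ t)` has derivative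
`−Σ_p (Re Tr M′_p) ∕ N` at `t₀`, where `M′_p` is any derivative of the plaquette matrix (e.g. §1's four-term Leibniz sum).
[cite: Balaban1985Variational, (5) p.278, Sect. F p.300; Balaban1987RG1, (0.2) p.252] -/
theorem hasDerivAt_wilsonAction4 (hγ : ∀ b, HasDerivAt (fun t => ((γ t b : SU N) : Matrix (Fin N) (Fin N) ℂ)) (X b) t₀)
    {M' : Plaq P j → Matrix (Fin N) (Fin N) ℂ}
    (hM : ∀ p, HasDerivAt (fun t => ((GaugeField.plaqHol (γ t) p : SU N) : Matrix (Fin N) (Fin N) ℂ)) (M' p) t₀) :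
    HasDerivAt (fun t => wilsonAction4 (γ t))
      (∑ p : Plaq P j, -(((Matrix.traceLinearMap (Fin N) ℝ ℂ) (M' p)).re / (Fintype.card (Fin N) : ℝ))) t₀ := by
  have hp : ∀ p : Plaq P j, HasDerivAt (fun t => (1 : ℝ) * (1 - reTr (GaugeField.plaqHol (γ t) p)))
      (-(((Matrix.traceLinearMap (Fin N) ℝ ℂ) (M' p)).re / (Fintype.card (Fin N) : ℝ))) t₀ := by
    intro p
    have h := ((hasDerivAt_const t₀ (1 : ℝ)).sub (hasDerivAt_reTr_plaqHol hγ p (hM p))).const_mul (1 : ℝ)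
    exact h.congr_deriv (by ring)
  unfold wilsonAction4 wilsonAction
  exact HasDerivAt.fun_sum fun p _ => hp p

end FirstVariation

/-! ## §2  The tangent condition from unitarity -/

section Tangent

variable {P : Params} {j : ℕ} {N : ℕ}
  {γ : ℝ → GaugeField P j (SU N)} {X : PBond P j → Matrix (Fin N) (Fin N) ℂ} {t₀ : ℝ}

/-- **THE TANGENT CONDITION** at each bond: differentiating `U⋆U = 1` along the curve gives `(X b)⋆·U + U⋆·X b = 0` (`U = ↑(γ t₀ b)`).
[cite: Balaban1985Variational, (4) p.278 (the group; bookkeeping)] -/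
theorem star_deriv_mul_add_eq_zero (hγ : ∀ b, HasDerivAt (fun t => ((γ t b : SU N) : Matrix (Fin N) (Fin N) ℂ)) (X b) t₀) (b : PBond P j) :
    star (X b) * ((γ t₀ b : SU N) : Matrix (Fin N) (Fin N) ℂ) + star ((γ t₀ b : SU N) : Matrix (Fin N) (Fin N) ℂ) * X b = 0 := by
  have h1 : HasDerivAt (fun t => star ((γ t b : SU N) : Matrix (Fin N) (Fin N) ℂ) * ((γ t b : SU N) : Matrix (Fin N) (Fin N) ℂ))
      (star (X b) * ((γ t₀ b : SU N) : Matrix (Fin N) (Fin N) ℂ) + star ((γ t₀ b : SU N) : Matrix (Fin N) (Fin N) ℂ) * X b) t₀ :=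
    (hγ b).star.mul (hγ b)
  have h2 : (fun t => star ((γ t b : SU N) : Matrix (Fin N) (Fin N) ℂ) * ((γ t b : SU N) : Matrix (Fin N) (Fin N) ℂ)) = fun _ => 1 := by
    funext t
    exact Matrix.mem_unitaryGroup_iff'.mp (γ t b).2.1
  rw [h2] at h1
  exact (h1.unique (hasDerivAt_const t₀ (1 : Matrix (Fin N) (Fin N) ℂ))).symm ▸ rfl

/-- Hence `U⋆·X b` is skew-adjoint: `(U⋆ X)⋆ = −U⋆ X`. [cite: Balaban1985Variational, (4) p.278 (bookkeeping)] -/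
theorem star_star_mul_deriv (hγ : ∀ b, HasDerivAt (fun t => ((γ t b : SU N) : Matrix (Fin N) (Fin N) ℂ)) (X b) t₀) (b : PBond P j) :
    star (star ((γ t₀ b : SU N) : Matrix (Fin N) (Fin N) ℂ) * X b) = -(star ((γ t₀ b : SU N) : Matrix (Fin N) (Fin N) ℂ) * X b) := by
  rw [star_mul, star_star]
  exact eq_neg_of_add_eq_zero_left (star_deriv_mul_add_eq_zero hγ b)

/-- **`Re Tr(U⋆·X b) = 0`**: the trace of a skew-adjoint matrix is purely imaginary. [cite: Balaban1985Variational, (4) p.278 (bookkeeping)] -/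
theorem re_trace_star_mul_deriv_eq_zero (hγ : ∀ b, HasDerivAt (fun t => ((γ t b : SU N) : Matrix (Fin N) (Fin N) ℂ)) (X b) t₀) (b : PBond P j) :
    (Matrix.trace (star ((γ t₀ b : SU N) : Matrix (Fin N) (Fin N) ℂ) * X b)).re = 0 := by
  set Y := star ((γ t₀ b : SU N) : Matrix (Fin N) (Fin N) ℂ) * X b with hY
  have hs : star Y = -Y := star_star_mul_deriv hγ b
  have h1 : Matrix.trace (star Y) = star (Matrix.trace Y) := Matrix.trace_conjTranspose Y
  rw [hs, Matrix.trace_neg] at h1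
  -- `-tr Y = conj (tr Y)` ⇒ `Re tr Y = 0`
  have h2 := congrArg Complex.re h1
  rw [Complex.neg_re, Complex.star_def, Complex.conj_re] at h2
  linarith

end Tangent

/-! ## §3  The criticality test: vanishing first variation ⇒ critical on every fibre -/

section CriticalityTest

variable {F : T4Family} {N : ℕ} [NeZero N]

/-- ★ **VANISHING FIRST VARIATION ⇒ CRITICAL ON EVERY FIBRE.**  If at a configuration `U` the first variation of (5) vanishes for EVERY velocity family `X` that
can arise as the bond-wise derivative of a curve through `U` — i.e. for every `X` with the tangent condition `(X b)⋆·↑(U b) + ↑(U b)⋆·X b = 0` at every bond —,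
then `U` is a critical configuration of (5) on the fibre of EVERY determining set and datum (`IsCritOnFibre F N K 𝐁 W U`): the constraint is not needed (an
unconstrained critical point is critical on every fibre through it).  This is the test an explicit lattice Yang–Mills solution has to pass.
[cite: Balaban1985Variational, (5) p.278, Sect. F p.300 («critical configurations of the functional (5)»)] -/
theorem isCritOnFibre_of_firstVariation_eq_zero {K : ℕ} {U : GaugeField (F.P K) 0 (SU N)}
    (h : ∀ X : PBond (F.P K) 0 → Matrix (Fin N) (Fin N) ℂ,
      (∀ b, star (X b) * ((U b : SU N) : Matrix (Fin N) (Fin N) ℂ) + star ((U b : SU N) : Matrix (Fin N) (Fin N) ℂ) * X b = 0) →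
      ∑ p : Plaq (F.P K) 0, ((Matrix.traceLinearMap (Fin N) ℝ ℂ)
        (X ⟨p.src, p.μ⟩ * (U ⟨p.src.shift p.μ, p.ν⟩ : Matrix (Fin N) (Fin N) ℂ) * star (U ⟨p.src.shift p.ν, p.μ⟩ : Matrix (Fin N) (Fin N) ℂ)
            * star (U ⟨p.src, p.ν⟩ : Matrix (Fin N) (Fin N) ℂ)
          + (U ⟨p.src, p.μ⟩ : Matrix (Fin N) (Fin N) ℂ) * X ⟨p.src.shift p.μ, p.ν⟩ * star (U ⟨p.src.shift p.ν, p.μ⟩ : Matrix (Fin N) (Fin N) ℂ)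
            * star (U ⟨p.src, p.ν⟩ : Matrix (Fin N) (Fin N) ℂ)
          + (U ⟨p.src, p.μ⟩ : Matrix (Fin N) (Fin N) ℂ) * (U ⟨p.src.shift p.μ, p.ν⟩ : Matrix (Fin N) (Fin N) ℂ) * star (X ⟨p.src.shift p.ν, p.μ⟩)
            * star (U ⟨p.src, p.ν⟩ : Matrix (Fin N) (Fin N) ℂ)
          + (U ⟨p.src, p.μ⟩ : Matrix (Fin N) (Fin N) ℂ) * (U ⟨p.src.shift p.μ, p.ν⟩ : Matrix (Fin N) (Fin N) ℂ)
            * star (U ⟨p.src.shift p.ν, p.μ⟩ : Matrix (Fin N) (Fin N) ℂ) * star (X ⟨p.src, p.ν⟩))).re = 0)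
    (𝔹 : DetSet (F.P K)) (W : MSField (F.P K) (SU N)) : IsCritOnFibre F N K 𝔹 W U := by
  intro γ h0 hd _ a ha
  -- bond-wise derivatives of the curve at `0`
  set X : PBond (F.P K) 0 → Matrix (Fin N) (Fin N) ℂ :=
    fun b => deriv (fun t => ((γ t b : SU N) : Matrix (Fin N) (Fin N) ℂ)) 0 with hX
  have hγ : ∀ b, HasDerivAt (fun t => ((γ t b : SU N) : Matrix (Fin N) (Fin N) ℂ)) (X b) 0 := by
    intro b
    have hb : DifferentiableAt ℝ (fun t => ((γ t b : SU N) : Matrix (Fin N) (Fin N) ℂ)) 0 :=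
      (differentiableAt_pi.1 hd) b
    exact hb.hasDerivAt
  subst h0
  have hA := hasDerivAt_wilsonAction4 hγ (fun p => hasDerivAt_coe_plaqHol hγ p)
  have hsum := h X (fun b => star_deriv_mul_add_eq_zero hγ b)
  have hA0 : HasDerivAt (fun t => wilsonAction4 (γ t)) 0 0 := hA.congr_deriv (by
    rw [Finset.sum_neg_distrib, ← Finset.sum_div, hsum, zero_div, neg_zero])
  exact ha.unique hA0

end CriticalityTest

end Literature.MathematicalPhysics.QuantumFieldTheory.Balaban1983to89.Node00

end
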